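import Summits.QuantumFields.YangMills.Theorems.VirialFluxGapTwistEaterSignClass
import HarnessLib

/-!
# Transversality of the residual constant `SU(2)` at a twist-eater: an explicit `O(1)` constant
# (layer (B2), input (ii), of the DIRECT Laplace road to ⟨stmt-QuantumFields-24204⟩ `VirialFluxGap.SharpTwistedLaplace`)

Helper module (free-hands work of width seat ym-line-sfw-p2-w2 g49, cell ym-idea-1).  After the tree gauge of
✓`VirialFluxGapRingTreeGauge` the only symmetry of the reduced ring integral is the CONSTANT `SU(2)` acting by conjugation; its orbit
map at a sign-class twist-eater ring `Q_s` moves (among others) one link carrying `±N₀` and one seam site carrying `±C₀`, where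
`(N₀, C₀)` is the reference pair (trace-free, orthogonal axes).  This file gives the EXPLICIT lower bound of that motion:
* `imDot_sub_proj_sq` — Bessel for an orthonormal pair of axes: `(v·n)² + (v·c)² ≤ |v|²`;
* ★ `four_mul_imDot_le_comm_sq_add` — `4|Im h|² ≤ ‖hn − nh‖² + ‖hc − ch‖²` for pure unit `n ⊥ c` and ANY quaternion `h`;
* `two_mul_min_le_four_mul_imDot` — for a unit quaternion `2·min(‖h − 1‖², ‖h + 1‖²) ≤ 4|Im h|²`;
* ★ `two_mul_min_le_conj_sub_sq_add` (`SU(2)` form) — for every `k ∈ SU(2)`: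
  `2·min(‖k − 1‖², ‖k + 1‖²) ≤ ‖k N₀ k⁻¹ − N₀‖² + ‖k C₀ k⁻¹ − C₀‖²` (norms of `su2Quat`), i.e. the residual orbit map is
  `√2`-bi-Lipschitz from `SU(2)/{±1}` at the identity, with a constant INDEPENDENT of `L` — input (ii) of memo
  `DIRECT-LAPLACE-24204-v4.md` §8 no longer needs a lattice Poincaré inequality.
Everything is PROVED; no definitions, no named facts.  HONEST FRAMING: quaternion algebra; ⟨24204⟩, ⟨24319⟩ and every rung stay
OPEN; the Yang–Mills mass gap (Clay) is NOT touched; no summit is proved by a line.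
-/

noncomputable section

open scoped Quaternion
open Literature.MathematicalPhysics.QuantumFieldTheory hiding SU2 su2Quat_mul
open Literature.MathematicalPhysics.QuantumLattice
open Literature.MathematicalPhysics.QuantumFieldTheory.Balaban1983to89.T4HaarSU2Translate (su2Quat_mul)
open Summit.QuantumFields.YangMills.Theorems.FemtoTransferGap
open Summit.QuantumFields.YangMills.Theorems.ToronValleyVolume.Lojasiewicz
open Summit.QuantumFields.YangMills.Theorems.TwistEaterVolume.Quadratic

namespace Summit.QuantumFields.YangMills.Theorems.QuantitativeLaplace

/-! ## §1 Quaternion form -/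

/-- **Bessel's inequality for two orthonormal axes** (components): `(v·n)² + (v·c)² ≤ |v|²`. [folklore] -/
theorem imDot_sub_proj_sq {v₁ v₂ v₃ n₁ n₂ n₃ c₁ c₂ c₃ : ℝ} (hn : n₁ * n₁ + n₂ * n₂ + n₃ * n₃ = 1)
    (hc : c₁ * c₁ + c₂ * c₂ + c₃ * c₃ = 1) (hnc : n₁ * c₁ + n₂ * c₂ + n₃ * c₃ = 0) :
    (v₁ * n₁ + v₂ * n₂ + v₃ * n₃) ^ 2 + (v₁ * c₁ + v₂ * c₂ + v₃ * c₃) ^ 2 ≤ v₁ * v₁ + v₂ * v₂ + v₃ * v₃ := by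
  have key : v₁ * v₁ + v₂ * v₂ + v₃ * v₃ - (v₁ * n₁ + v₂ * n₂ + v₃ * n₃) ^ 2 - (v₁ * c₁ + v₂ * c₂ + v₃ * c₃) ^ 2 =
      (v₁ - (v₁ * n₁ + v₂ * n₂ + v₃ * n₃) * n₁ - (v₁ * c₁ + v₂ * c₂ + v₃ * c₃) * c₁) ^ 2 +
        (v₂ - (v₁ * n₁ + v₂ * n₂ + v₃ * n₃) * n₂ - (v₁ * c₁ + v₂ * c₂ + v₃ * c₃) * c₂) ^ 2 +
        (v₃ - (v₁ * n₁ + v₂ * n₂ + v₃ * n₃) * n₃ - (v₁ * c₁ + v₂ * c₂ + v₃ * c₃) * c₃) ^ 2 := by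
    linear_combination (-((v₁ * n₁ + v₂ * n₂ + v₃ * n₃) ^ 2)) * hn + (-((v₁ * c₁ + v₂ * c₂ + v₃ * c₃) ^ 2)) * hc +
      (-(2 * (v₁ * n₁ + v₂ * n₂ + v₃ * n₃) * (v₁ * c₁ + v₂ * c₂ + v₃ * c₃))) * hnc
  nlinarith [key, sq_nonneg (v₁ - (v₁ * n₁ + v₂ * n₂ + v₃ * n₃) * n₁ - (v₁ * c₁ + v₂ * c₂ + v₃ * c₃) * c₁),
    sq_nonneg (v₂ - (v₁ * n₁ + v₂ * n₂ + v₃ * n₃) * n₂ - (v₁ * c₁ + v₂ * c₂ + v₃ * c₃) * c₂),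
    sq_nonneg (v₃ - (v₁ * n₁ + v₂ * n₂ + v₃ * n₃) * n₃ - (v₁ * c₁ + v₂ * c₂ + v₃ * c₃) * c₃)]

/-- ★ **Transversality of conjugation at an orthogonal pair of pure unit quaternions**: for pure unit `n ⊥ c` and ANY `h`,
`4·|Im h|² ≤ ‖hn − nh‖² + ‖hc − ch‖²`. [folklore] -/
theorem four_mul_imDot_le_comm_sq_add {h n c : ℍ} (hn1 : ‖n‖ = 1) (hnre : n.re = 0) (hc1 : ‖c‖ = 1) (hcre : c.re = 0)
    (hnc : n.imI * c.imI + n.imJ * c.imJ + n.imK * c.imK = 0) :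
    4 * (h.imI * h.imI + h.imJ * h.imJ + h.imK * h.imK) ≤ ‖h * n - n * h‖ ^ 2 + ‖h * c - c * h‖ ^ 2 := by
  have hn' := imDot_eq_one_of_pure hn1 hnre
  have hc' := imDot_eq_one_of_pure hc1 hcre
  rw [normSq_comm_eq, normSq_comm_eq, hn', hc', mul_one]
  have hb := imDot_sub_proj_sq (v₁ := h.imI) (v₂ := h.imJ) (v₃ := h.imK) hn' hc' hnc
  linarith

/-- For a UNIT quaternion, `2·min(‖h − 1‖², ‖h + 1‖²) ≤ 4·|Im h|²`. [folklore] -/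
theorem two_mul_min_le_four_mul_imDot {h : ℍ} (hh : ‖h‖ = 1) :
    2 * min (‖h - 1‖ ^ 2) (‖h + 1‖ ^ 2) ≤ 4 * (h.imI * h.imI + h.imJ * h.imJ + h.imK * h.imK) := by
  have hu : h.re ^ 2 + (h.imI * h.imI + h.imJ * h.imJ + h.imK * h.imK) = 1 := by
    rw [← norm_sq_eq_re_sq_add_imDot, hh, one_pow]
  have hm : ‖h - 1‖ ^ 2 = 2 - 2 * h.re := by
    rw [norm_sq_eq_re_sq_add_imDot]
    simp only [Quaternion.re_sub, Quaternion.imI_sub, Quaternion.imJ_sub, Quaternion.imK_sub, Quaternion.re_one,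
      Quaternion.imI_one, Quaternion.imJ_one, Quaternion.imK_one, sub_zero]
    nlinarith [hu]
  have hp : ‖h + 1‖ ^ 2 = 2 + 2 * h.re := by
    rw [norm_sq_eq_re_sq_add_imDot]
    simp only [Quaternion.re_add, Quaternion.imI_add, Quaternion.imJ_add, Quaternion.imK_add, Quaternion.re_one,
      Quaternion.imI_one, Quaternion.imJ_one, Quaternion.imK_one, add_zero]
    nlinarith [hu]
  have hD : 4 * (h.imI * h.imI + h.imJ * h.imJ + h.imK * h.imK) = (2 - 2 * h.re) * (2 + 2 * h.re) := by nlinarith [hu]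
  rw [hm, hp, hD]
  have h0m : 0 ≤ 2 - 2 * h.re := by rw [← hm]; positivity
  have h0p : 0 ≤ 2 + 2 * h.re := by rw [← hp]; positivity
  rcases le_total (2 - 2 * h.re) (2 + 2 * h.re) with hle | hle
  · rw [min_eq_left hle]; nlinarith
  · rw [min_eq_right hle]; nlinarith

/-- ★ Quaternion form of the residual transversality: for unit `h` and pure unit `n ⊥ c`,
`2·min(‖h − 1‖², ‖h + 1‖²) ≤ ‖hn − nh‖² + ‖hc − ch‖²`. [folklore] -/
theorem two_mul_min_le_comm_sq_add {h n c : ℍ} (hh : ‖h‖ = 1) (hn1 : ‖n‖ = 1) (hnre : n.re = 0) (hc1 : ‖c‖ = 1)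
    (hcre : c.re = 0) (hnc : n.imI * c.imI + n.imJ * c.imJ + n.imK * c.imK = 0) :
    2 * min (‖h - 1‖ ^ 2) (‖h + 1‖ ^ 2) ≤ ‖h * n - n * h‖ ^ 2 + ‖h * c - c * h‖ ^ 2 :=
  (two_mul_min_le_four_mul_imDot hh).trans (four_mul_imDot_le_comm_sq_add hn1 hnre hc1 hcre hnc)

/-! ## §2 `SU(2)` form -/

/-- Conjugation versus commutator: `‖su2Quat(k g k⁻¹) − su2Quat g‖ = ‖su2Quat k · su2Quat g − su2Quat g · su2Quat k‖`. [folklore] -/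
theorem norm_su2Quat_conj_sub (k g : SU2) :
    ‖su2Quat (k * g * k⁻¹) - su2Quat g‖ = ‖su2Quat k * su2Quat g - su2Quat g * su2Quat k‖ := by
  have hk1 : ‖su2Quat k‖ = 1 := norm_su2Quat k
  have e : su2Quat (k * g * k⁻¹) - su2Quat g = (su2Quat k * su2Quat g - su2Quat g * su2Quat k) * su2Quat k⁻¹ := by
    have hinv : su2Quat k * su2Quat k⁻¹ = 1 := by rw [← su2Quat_mul, mul_inv_cancel, FemtoTransferGap.su2Quat_one]
    rw [su2Quat_mul, su2Quat_mul, sub_mul, mul_assoc (su2Quat g), hinv, mul_one]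
  rw [e, norm_mul, norm_su2Quat, mul_one]

/-- ★ **Residual transversality, `SU(2)` form**: for every `k ∈ SU(2)` and a reference pair `(N₀, C₀)` of trace-free elements
with orthogonal axes, `2·min(‖k − 1‖², ‖k + 1‖²) ≤ ‖k N₀ k⁻¹ − N₀‖² + ‖k C₀ k⁻¹ − C₀‖²` (norms of `su2Quat`): the constant
does not depend on `L`. [folklore] -/
theorem two_mul_min_le_conj_sub_sq_add (k : SU2) {N₀ C₀ : SU2} (hN : (su2Quat N₀).re = 0) (hC : (su2Quat C₀).re = 0)
    (hNC : (su2Quat N₀).imI * (su2Quat C₀).imI + (su2Quat N₀).imJ * (su2Quat C₀).imJ +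
      (su2Quat N₀).imK * (su2Quat C₀).imK = 0) :
    2 * min (‖su2Quat k - 1‖ ^ 2) (‖su2Quat k + 1‖ ^ 2) ≤
      ‖su2Quat (k * N₀ * k⁻¹) - su2Quat N₀‖ ^ 2 + ‖su2Quat (k * C₀ * k⁻¹) - su2Quat C₀‖ ^ 2 := by
  rw [norm_su2Quat_conj_sub, norm_su2Quat_conj_sub]
  exact two_mul_min_le_comm_sq_add (norm_su2Quat k) (norm_su2Quat N₀) hN (norm_su2Quat C₀) hC hNC

end Summit.QuantumFields.YangMills.Theorems.QuantitativeLaplace
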